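import Literature.AlgebraicGeometry.Resolution.GenericFormSimpleZeros
import Literature.AlgebraicGeometry.Resolution.FormsOnAffineCharts
import Literature.AlgebraicGeometry.Morphisms.FiniteOfClosedFibres
import Mathlib.RingTheory.KrullDimension.Polynomial
import HarnessLib

/-!
# Bookkeeping for the generic hyperplane section: finite chart families, supports of products, finiteness

Topic: `Literature/AlgebraicGeometry/Resolution`. Pure proofs (no definition, no named fact) of
the elementary bookkeeping used to assemble the hypersurface section `H = X ∩ V₊(G₁G₂G₃)` of
de Jong's proof of his multisection lemma (de Jong 1996, Lemma 4.13, pp. 69–70) from the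
chart-wise genericity statements (`GenericFormMissesFibreComponents`, `GenericFormSimpleZeros`):

* `exists_nat_ringKrullDim_le` — a finitely generated algebra over a field has Krull dimension
  bounded by a natural number (it is a quotient of a polynomial ring);
* `LocallyGenerates.mul_of_not_mem` — a local generator times a local unit is a local generator;
* `mem_support_zeroIdeal_secOfForm_mul_iff` — the support of `X ∩ V₊(F₁F₂)` is the union of the
  supports of `X ∩ V₊(F₁)` and `X ∩ V₊(F₂)`;
* `exists_finset_basicOpen_cover`, `exists_finset_basicOpen_cover_of_subset` — finitely many
  basic open charts `(r⁻¹D₊(xᵢ))_h`, each mapping into an affine open of the base (resp. inside a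
  given open), cover the quasi-compact `X` (resp. any subset of a Noetherian `X`);
* `topologicalKrullDim_support_inter_preimage_le_zero_of_isFinite`,
  `isFinite_subschemeι_comp_of_closedPoints` — for `H = V(I) ⊆ X` and `f : X → Y`: if
  `H → Y` is finite then every `H ∩ f⁻¹(y')` has dimension `≤ 0`, and conversely for `H → Y`
  proper over a Jacobson `Y` it suffices to know this at the closed points (de Jong: "`f|_H` is
  quasi-finite hence finite", via `Morphisms/FiniteOfClosedFibres.lean`).

## References

* A. J. de Jong, *Smoothness, semi-stability and alterations*, Publ. Math. IHÉS 83 (1996),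
  Lemma 4.13 (proof), pp. 69–70. [DeJong1996]
-/

noncomputable section

universe u v

open CategoryTheory AlgebraicGeometry Limits TopologicalSpace Opposite Topology
open Literature.AlgebraicGeometry.Motives Literature.AlgebraicGeometry.Motives.Segre
  Literature.AlgebraicGeometry.Motives.GeneratingSections

namespace Literature.AlgebraicGeometry.Resolution

/-! ### Algebra -/

section Algebra

/-- **A finitely generated algebra over a field has finite Krull dimension**: it is a quotient of
a polynomial ring `k[T₁, …, T_e]`, of dimension `e` (bookkeeping for the dimension count of
de Jong's proof of 4.13: the bound `e` fed to `GenericFormMissesFibreComponents`). [cite: DeJong1996, Lemma 4.13 (proof), pp. 69–70] -/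
theorem exists_nat_ringKrullDim_le (k : Type u) [Field k] (A : Type v) [CommRing A] [Algebra k A]
    [Algebra.FiniteType k A] : ∃ e : ℕ, ringKrullDim A ≤ e := by
  obtain ⟨e, φ, hφ⟩ := Algebra.FiniteType.iff_quotient_mvPolynomial''.mp
    (inferInstance : Algebra.FiniteType k A)
  refine ⟨e, (ringKrullDim_le_of_surjective φ.toRingHom hφ).trans ?_⟩
  rw [MvPolynomial.ringKrullDim_of_isNoetherianRing, ringKrullDim_eq_zero_of_isField
    (Field.toIsField k), Nat.card_eq_fintype_card, Fintype.card_fin, zero_add]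

variable {D : Type*} [CommSemiring D]

/-- **A local generator times a local unit is a local generator**: if `g` generates the prime `𝔪`
locally and `u ∉ 𝔪`, then so does `g u` (used for the local equation `g₁g₂g₃` of
`H = X ∩ V₊(G₁G₂G₃)` at a point where only one factor vanishes; de Jong's proof of 4.13,
"`H ∩ f⁻¹(y)` is a reduced scheme"). [cite: DeJong1996, Lemma 4.13 (proof), pp. 69–70] -/
theorem LocallyGenerates.mul_of_not_mem {𝔪 : Ideal D} [𝔪.IsPrime] {g u : D}
    (hg : LocallyGenerates 𝔪 g) (hu : u ∉ 𝔪) : LocallyGenerates 𝔪 (g * u) := by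
  intro d hd
  obtain ⟨s, hs, hsd⟩ := hg d hd
  obtain ⟨r, hr⟩ := Ideal.mem_span_singleton'.mp hsd
  refine ⟨s * u, fun h => hs (((Ideal.IsPrime.mem_or_mem inferInstance h).resolve_right hu)), ?_⟩
  rw [mul_comm s u, mul_assoc, ← hr, ← mul_assoc, mul_comm u r, mul_assoc, mul_comm u g]
  exact Ideal.mul_mem_left _ _ (Ideal.mem_span_singleton_self _)

/-- The same with the unit on the left. [cite: DeJong1996, Lemma 4.13 (proof), pp. 69–70] -/
theorem LocallyGenerates.mul_of_not_mem_left {𝔪 : Ideal D} [𝔪.IsPrime] {g u : D}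
    (hg : LocallyGenerates 𝔪 g) (hu : u ∉ 𝔪) : LocallyGenerates 𝔪 (u * g) := by
  rw [mul_comm]; exact hg.mul_of_not_mem hu

end Algebra

/-! ### Supports of hypersurface sections of products -/

section Support

variable {k : Type u} [Field k] {Z : SchemeOver k} {n : ℕ} (ι : Z ⟶ projectiveSpace n k)
  [IsClosedImmersion ι.left] [QuasiSeparatedSpace Z.left]

/-- **`X ∩ V₊(F₁ F₂) = (X ∩ V₊(F₁)) ∪ (X ∩ V₊(F₂))` on supports**: the chart values are
multiplicative and `X_{ab} = X_a ∩ X_b` (the hypersurface section of de Jong's 4.13 is taken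
here with a product of three forms). [cite: DeJong1996, Lemma 4.13 (proof), pp. 69–70] -/
theorem mem_support_zeroIdeal_secOfForm_mul_iff {d₁ d₂ : ℕ} (F₁ F₂ : MvPolynomial (Fin (n + 1)) k)
    (h₁ : F₁.IsHomogeneous d₁) (h₂ : F₂.IsHomogeneous d₂) (x : Z.left) :
    x ∈ (((ofHom (emb ι)).secOfForm Z.hom (F₁ * F₂) (h₁.mul h₂)).zeroIdeal.support : Set Z.left) ↔
      x ∈ (((ofHom (emb ι)).secOfForm Z.hom F₁ h₁).zeroIdeal.support : Set Z.left) ∨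
        x ∈ (((ofHom (emb ι)).secOfForm Z.hom F₂ h₂).zeroIdeal.support : Set Z.left) := by
  haveI : IsClosedImmersion (emb ι) := ‹_›
  obtain ⟨i, hxi⟩ : ∃ i, x ∈ (ofHom (emb ι)).U i := by
    have h : x ∈ (⨆ i, (ofHom (emb ι)).U i : Z.left.Opens) := by
      rw [(ofHom (emb ι)).iSup_U]; trivial
    exact Opens.mem_iSup.mp h
  have hU := isAffineOpen_ofHom_U (emb ι)
  simp only [SetLike.mem_coe]
  rw [((ofHom (emb ι)).secOfForm Z.hom (F₁ * F₂) (h₁.mul h₂)).mem_support_zeroIdeal_iff hU hxi,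
    ((ofHom (emb ι)).secOfForm Z.hom F₁ h₁).mem_support_zeroIdeal_iff hU hxi,
    ((ofHom (emb ι)).secOfForm Z.hom F₂ h₂).mem_support_zeroIdeal_iff hU hxi,
    secOfForm_val, secOfForm_val, secOfForm_val, map_mul, Scheme.basicOpen_mul]
  change ¬ (x ∈ (_ ⊓ _ : Z.left.Opens)) ↔ _
  rw [Opens.mem_inf]
  tauto

end Support

/-! ### Finite families of basic open charts -/

section Charts

variable {k : Type u} [Field k] {Z : SchemeOver k} {n : ℕ} (ι : Z ⟶ projectiveSpace n k)
  [IsClosedImmersion ι.left] {Y : Scheme.{u}} (f : Z.left ⟶ Y)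

/-- **Finitely many basic open charts, each over an affine open of the base, cover `X`.** For
`r : X ↪ ℙⁿ_k` closed with `X` quasi-compact and `f : X → Y`: there are finitely many triples
`(U, i, h)` — `U ⊆ Y` affine open, `h ∈ Γ(X, r⁻¹D₊(xᵢ))` with `(r⁻¹D₊(xᵢ))_h ⊆ f⁻¹(U)` — whose
basic opens `(r⁻¹D₊(xᵢ))_h` cover `X` (the finitely many charts on which the genericity
conditions of de Jong's proof of 4.13 are imposed). [cite: DeJong1996, Lemma 4.13 (proof), pp. 69–70] -/
theorem exists_finset_basicOpen_cover [CompactSpace Z.left] :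
    ∃ t : Finset (Σ (U : Y.affineOpens) (i : Fin (n + 1)),
        {h : Γ(Z.left, preU (emb ι) i) // Z.left.basicOpen h ≤ f ⁻¹ᵁ (U : Y.Opens)}),
      ∀ x : Z.left, ∃ a ∈ t, x ∈ Z.left.basicOpen a.2.2.1 := by
  haveI : IsClosedImmersion (emb ι) := ‹_›
  let A := Σ (U : Y.affineOpens) (i : Fin (n + 1)),
    {h : Γ(Z.left, preU (emb ι) i) // Z.left.basicOpen h ≤ f ⁻¹ᵁ (U : Y.Opens)}
  let V : A → Set Z.left := fun a => Z.left.basicOpen a.2.2.1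
  have hVo : ∀ a, IsOpen (V a) := fun a => (Z.left.basicOpen a.2.2.1).2
  have hcov : (Set.univ : Set Z.left) ⊆ ⋃ a, V a := by
    intro x _
    obtain ⟨i, hxi⟩ : ∃ i, x ∈ (ofHom (emb ι)).U i := by
      have h : x ∈ (⨆ i, (ofHom (emb ι)).U i : Z.left.Opens) := by
        rw [(ofHom (emb ι)).iSup_U]; trivial
      exact Opens.mem_iSup.mp h
    obtain ⟨U, hU, hxU, -⟩ :=
      exists_isAffineOpen_mem_and_subset (X := Y) (x := f x) (U := ⊤) (Opens.mem_top _)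
    obtain ⟨h, hle, hxh⟩ := (isAffineOpen_ofHom_U (emb ι) i).exists_basicOpen_le
      (V := f ⁻¹ᵁ U) ⟨x, hxU⟩ hxi
    exact Set.mem_iUnion.mpr ⟨⟨⟨U, hU⟩, i, ⟨h, hle⟩⟩, hxh⟩
  obtain ⟨t, ht⟩ := isCompact_univ.elim_finite_subcover V hVo hcov
  refine ⟨t, fun x => ?_⟩
  have hx := ht (Set.mem_univ x)
  simp only [Set.mem_iUnion] at hx
  obtain ⟨a, ha, hxa⟩ := hx
  exact ⟨a, ha, hxa⟩

/-- **Finitely many basic open charts inside a given open cover a given subset** (of a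
Noetherian `X`, in which every subset is quasi-compact): for an open `O ⊆ X` and `S ⊆ O` there
are finitely many pairs `(i, h)` with `(r⁻¹D₊(xᵢ))_h ⊆ O` whose basic opens cover `S`. Used with
`O = f⁻¹(U₀) ∖ (f⁻¹(y) ∖ sm(f))` and `S = f⁻¹(y) ∩ sm(f)` in de Jong's proof of 4.13. [cite: DeJong1996, Lemma 4.13 (proof), pp. 69–70] -/
theorem exists_finset_basicOpen_cover_of_subset [NoetherianSpace Z.left] (O : Z.left.Opens)
    {S : Set Z.left} (hS : S ⊆ O) :
    ∃ t : Finset (Σ (i : Fin (n + 1)), {h : Γ(Z.left, preU (emb ι) i) // Z.left.basicOpen h ≤ O}),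
      S ⊆ ⋃ a ∈ t, (Z.left.basicOpen a.2.1 : Set Z.left) := by
  haveI : IsClosedImmersion (emb ι) := ‹_›
  let A := Σ (i : Fin (n + 1)), {h : Γ(Z.left, preU (emb ι) i) // Z.left.basicOpen h ≤ O}
  let V : A → Set Z.left := fun a => Z.left.basicOpen a.2.1
  have hVo : ∀ a, IsOpen (V a) := fun a => (Z.left.basicOpen a.2.1).2
  have hcov : S ⊆ ⋃ a, V a := by
    intro x hx
    obtain ⟨i, hxi⟩ : ∃ i, x ∈ (ofHom (emb ι)).U i := by
      have h : x ∈ (⨆ i, (ofHom (emb ι)).U i : Z.left.Opens) := by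
        rw [(ofHom (emb ι)).iSup_U]; trivial
      exact Opens.mem_iSup.mp h
    obtain ⟨h, hle, hxh⟩ := (isAffineOpen_ofHom_U (emb ι) i).exists_basicOpen_le
      (V := O) ⟨x, hS hx⟩ hxi
    exact Set.mem_iUnion.mpr ⟨⟨i, ⟨h, hle⟩⟩, hxh⟩
  obtain ⟨t, ht⟩ := (NoetherianSpace.isCompact S).elim_finite_subcover V hVo hcov
  exact ⟨t, ht⟩

end Charts

/-! ### Dimension of `H ∩ f⁻¹(y')` and finiteness of `H → Y` -/

section Finite

variable {X Y : Scheme.{u}} (f : X ⟶ Y) (I : X.IdealSheafData)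

/-- `H ∩ f⁻¹(y)` (`H = V(I)`, as a subset of `X`) is the image under `V(I) ↪ X` of the fibre
`(V(I) → X → Y)⁻¹(y)` (bookkeeping between `H ∩ f⁻¹(y)` and the fibre of `f|_H`). [cite: DeJong1996, Lemma 4.13 (proof), pp. 69–70] -/
theorem support_inter_preimage_eq_image (y : Y) :
    (I.support : Set X) ∩ f ⁻¹' {y} = I.subschemeι '' ((I.subschemeι ≫ f) ⁻¹' {y}) := by
  ext x
  constructor
  · rintro ⟨hxH, hxy⟩
    obtain ⟨z, rfl⟩ : x ∈ Set.range I.subschemeι := by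
      rw [Scheme.IdealSheafData.range_subschemeι]; exact hxH
    exact ⟨z, show (I.subschemeι ≫ f) z ∈ ({y} : Set Y) by
      rw [Scheme.Hom.comp_apply]; exact hxy, rfl⟩
  · rintro ⟨z, hz, rfl⟩
    refine ⟨?_, ?_⟩
    · rw [← Scheme.IdealSheafData.range_subschemeι]; exact ⟨z, rfl⟩
    · show f (I.subschemeι z) ∈ ({y} : Set Y)
      rw [← Scheme.Hom.comp_apply]; exact hz

/-- **If `H = V(I) → Y` is finite, every `H ∩ f⁻¹(y')` has Krull dimension `≤ 0`** (as a
subspace of `X`): the fibres of a finite morphism are discrete, and `V(I) ↪ X` is an embedding.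
[cite: DeJong1996, Lemma 4.13 (proof), p. 70] -/
theorem topologicalKrullDim_support_inter_preimage_le_zero_of_isFinite
    [IsFinite (I.subschemeι ≫ f)] (y : Y) :
    topologicalKrullDim ↥((I.support : Set X) ∩ f ⁻¹' {y}) ≤ 0 := by
  have hdisc : _root_.IsDiscrete ((I.subschemeι ≫ f) ⁻¹' ({y} : Set Y)) :=
    (I.subschemeι ≫ f).isDiscrete_preimage_singleton y
  have himg := hdisc.image I.subschemeι.isClosedEmbedding.isEmbedding.isInducing
  rw [← support_inter_preimage_eq_image f I y] at himg
  exact Literature.AlgebraicGeometry.Morphisms.topologicalKrullDim_le_zero_of_isDiscrete himg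

/-- **`H = V(I) → Y` proper over a Jacobson `Y` with `dim (H ∩ f⁻¹(y)) ≤ 0` at every closed point
`y` is finite** (de Jong: "`f|_H : H → Y` is quasi-finite hence finite";
`Morphisms.isFinite_of_isProper_of_topologicalKrullDim_preimage_le_zero`, the dimension being
transported along the embedding `V(I) ↪ X`). [cite: DeJong1996, Lemma 4.13 (proof), p. 70] -/
theorem isFinite_subschemeι_comp_of_closedPoints [IsProper (I.subschemeι ≫ f)] [JacobsonSpace Y]
    (h : ∀ y : Y, IsClosed ({y} : Set Y) →
      topologicalKrullDim ↥((I.support : Set X) ∩ f ⁻¹' {y}) ≤ 0) :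
    IsFinite (I.subschemeι ≫ f) := by
  refine Literature.AlgebraicGeometry.Morphisms.isFinite_of_isProper_of_topologicalKrullDim_preimage_le_zero
    (I.subschemeι ≫ f) fun y hy => ?_
  -- the fibre of `V(I) → Y` embeds into `H ∩ f⁻¹(y) ⊆ X`
  set S : Set I.subscheme := (I.subschemeι ≫ f) ⁻¹' {y} with hS
  set T : Set X := (I.support : Set X) ∩ f ⁻¹' {y} with hT
  have hmap : ∀ z : S, I.subschemeι z.1 ∈ T := fun z => by
    rw [hT, support_inter_preimage_eq_image f I y]
    exact ⟨z.1, z.2, rfl⟩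
  let r : S → T := fun z => ⟨I.subschemeι z.1, hmap z⟩
  have hr : Topology.IsInducing r := by
    have h1 : Topology.IsInducing (fun z : S => I.subschemeι z.1) :=
      I.subschemeι.isClosedEmbedding.isEmbedding.isInducing.comp Topology.IsInducing.subtypeVal
    exact Topology.IsInducing.codRestrict h1 hmap
  exact hr.topologicalKrullDim_le.trans (h y hy)

end Finite

end Literature.AlgebraicGeometry.Resolution

end
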